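import Summits.BirchSwinnertonDyer.Rank1Residual.X11b.Three.ClassRecordAtThree
import Summits.BirchSwinnertonDyer.Rank1Residual.X11b.RegMultCertificateJoin
import HarnessLib

/-!
# Class X11b at `p = 3` (team N8/O2, seat x11b3-p2, LEAD DEAL #5 (R5-8)(ii)): the `hReg` binder of
# CLASS RECORD v4 (`Three.forall_bsdp_of_classRecord`, road (a) NONSPLIT(3) ∧ (ram)) is supplied,
# pair by pair, by REGMULT non-split certificates (`RegMult.CertNonsplit`, census-ctyper-2's join)

HONEST FRAMING (verbatim, cell `b2b-bsdres`, run/shared/lean/b2b/bsd-rank1-residual/): the goal of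
the cell is to DELETE the COMBINATION-SHAPED residual classes for ALL analytic-rank `≤ 1` curves
over `ℚ` — "full BSD formula for every rank `≤ 1` curve in class `C`" assembled STRICTLY from
published theorems — so that the rank-`≤ 1` remainder becomes exactly the CONSTRUCTION-SHAPED
classes, which are TYPED (missing-input Props), NOT attempted; this is not "finishing BSD".
Research route (team N8/O2 at `p = 3`); nothing booked; no label or RESIDUAL-MAP mark touched;
X11b@3 stays OPEN / CONSTRUCTION-SHAPED (R6.2). A REGMULT row is a per-pair COMPUTED INPUT
(instrumentation tier, EVIDENCE; booking = referee A's ruling); Schneider's conjecture is asserted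
for NO class (barrier `Literature/Barriers/BirchSwinnertonDyer/PAdicHeightNondegeneracy`).
THEOREMS ONLY; no definition; no named fact; no `sorry`.

## What (three short bridges; names coordinated with census-ctyper-2's `RegMultCertificateJoin`)

* `Three.regulatorNonvanishingAt_of_certNonsplit` — per pair, any prime `p`: on an X11b pair that is
  NOT split multiplicative at `p`, ONE non-split certificate `RegMult.CertNonsplit W p P m` gives the
  bundled road-(a) input `ClassClosure.RegulatorNonvanishingAt W p` (rank one from GZK via
  `mordellWeilRank_eq_one_of_analyticRank`; the split half is vacuous,
  `RegMult.regulatorNonvanishingAt_of_cert_of_not_split` = p3's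
  `Three.regulatorNonvanishingAt_iff_of_nonsplit` read backwards).
* `Three.hReg_of_certNonsplit` — the class-level SUPPLY form: a certificate for every X11b@3 pair
  that is (ram) and non-split at `3` yields VERBATIM the binder `hReg` of
  `Three.forall_bsdp_of_classRecord` (p252266).
* `Three.forall_bsdp_of_classRecord_of_certNonsplit` — CLASS RECORD v4 with `hReg` REPLACED by that
  certificate supply (all other binders unchanged and passed through).

What this is NOT: no certificate is produced here (rows are EVIDENCE, `HOME/…/census/regmult/`,
`REGMULT-PAIR/v1`); nothing booked; the TIER of "BSD₃ on nonsplit ∧ Ram modulo a certified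
`Reg₃ ≠ 0`" is referee A's open question.

References: W. Stein, C. Wuthrich, Math. Comp. 82 (2013) §4.2, Thm. 6.1 [SteinWuthrich2013];
C. Skinner, Pacific J. Math. 283 (2016) Thm. A [Skinner2016PacificMC]; D. Disegni, Kyoto J. Math.
60 (2020) Thm. 1 [Disegni2020]; team files `cells/x11b3/OWNERS.md` LEAD DEAL #5 (R5-8),
CLASS RECORD v4, `HOME/b2b-bsdres-census-ctyper2/regmult/REG-MULT-CERT-SCHEMA.md` §3.
-/

noncomputable section

open scoped Classical

open WeierstrassCurve NumberField IsDedekindDomain Field Literature.NumberTheory.EllipticCurves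
  Rat.HeightOneSpectrum
  Literature.NumberTheory.DiophantineGeometry
  Literature.NumberTheory.EllipticCurves.GreenbergSelmer
  Literature.NumberTheory.EllipticCurves.ModularForms
  Literature.NumberTheory.EllipticCurves.Rank1Residual
  Literature.NumberTheory.EllipticCurves.Rank1Residual.Typed
  Literature.NumberTheory.EllipticCurves.Wuthrich2014
  Literature.NumberTheory.EllipticCurves.BalakrishnanEtAl2019
  Literature.NumberTheory.EllipticCurves.Skinner2016
  Literature.NumberTheory.EllipticCurves.SteinWuthrich2013
  Literature.NumberTheory.EllipticCurves.Disegni2020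
  Literature.NumberTheory.EllipticCurves.BarriosEtAl2025
  Literature.NumberTheory.QuadraticFields.Quadratic
  Literature.NumberTheory.Automorphic
  Literature.NumberTheory.GaloisRepresentations Literature.NumberTheory.GaloisCohomology
  Summit.BirchSwinnertonDyer.Rank1Residual.X11b.AcSelmer
  Summit.BirchSwinnertonDyer.Rank1Residual.X11b.LocBridge

namespace Summit.BirchSwinnertonDyer.Rank1Residual.X11b.Three

/-- **Per pair: one non-split REGMULT certificate is road (a)'s whole input.** On an X11b pair
`(E, p)` (so `r_an = 1`, hence Mordell–Weil rank one by GZK) that is not split multiplicative at `p`,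
`RegMult.CertNonsplit W p P m` gives `ClassClosure.RegulatorNonvanishingAt W p`. CONDITIONAL on the
certificate (a per-pair computed input); nothing booked. [cite: SteinWuthrich2013, §4.2] -/
theorem regulatorNonvanishingAt_of_certNonsplit
    (hGZK : rank_eq_analyticRank_of_analyticRank_le_one)
    {W : WeierstrassCurve ℚ} [W.IsElliptic] [W.IsGloballyMinimal] {p : ℕ} [Fact p.Prime]
    (hX : ClassX11b W p) (hns : ¬ W.HasSplitMultiplicativeReductionAtPrime p)
    {P : W.toAffine.Point} {m : ℕ} (hc : RegMult.CertNonsplit W p P m) :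
    ClassClosure.RegulatorNonvanishingAt W p :=
  RegMult.regulatorNonvanishingAt_of_cert_of_not_split
    (mordellWeilRank_eq_one_of_analyticRank hGZK hX.1) hns hc

/-- **The `hReg` binder of CLASS RECORD v4 from a certificate supply.** If every X11b@3 pair that
is (ram) and non-split at `3` comes with a non-split REGMULT certificate, then road (a)'s binder
`hReg` of `Three.forall_bsdp_of_classRecord` holds verbatim. CONDITIONAL; the supply is a family of
per-pair computed inputs (EVIDENCE rows), never a class-level assertion of Schneider's conjecture.
[cite: SteinWuthrich2013, §4.2] -/
theorem hReg_of_certNonsplit (hGZK : rank_eq_analyticRank_of_analyticRank_le_one)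
    (hcert : ∀ (W : WeierstrassCurve ℚ) [W.IsElliptic] [W.IsGloballyMinimal],
      ClassX11b W 3 → Ram W 3 → ¬ W.HasSplitMultiplicativeReductionAtPrime 3 →
        ∃ (P : W.toAffine.Point) (m : ℕ), RegMult.CertNonsplit W 3 P m) :
    ∀ (W : WeierstrassCurve ℚ) [W.IsElliptic] [W.IsGloballyMinimal],
      ClassX11b W 3 → Ram W 3 → ¬ W.HasSplitMultiplicativeReductionAtPrime 3 →
        ClassClosure.RegulatorNonvanishingAt W 3 := by
  intro W _ _ hX hram hns
  obtain ⟨P, m, hc⟩ := hcert W hX hram hns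
  exact regulatorNonvanishingAt_of_certNonsplit hGZK hX hns hc

/-- **CLASS RECORD v4 with road (a)'s binder fed by REGMULT certificates.**
`Three.forall_bsdp_of_classRecord` (p3, p252266) with `hReg` replaced by a non-split certificate for
every (ram) ∧ nonsplit(3) pair; every other binder (the published facts, road (b)'s open input `hL`,
the displays `hSh`, the (T2α)/(T2γ) Euler-system halves, road (d), the corner) is passed through
UNCHANGED. CONDITIONAL on all of them; nothing booked; X11b@3 stays OPEN.
[cite: SteinWuthrich2013, §4.2] [cite: Skinner2016PacificMC, Thm. A] [cite: Disegni2020, Thm. 1] -/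
theorem forall_bsdp_of_classRecord_of_certNonsplit [Fact (Nat.Prime 3)]
    (hGZ : ∀ (N : ℕ) [NeZero N] (W : WeierstrassCurve ℚ) (K : Type) [Field K] [NumberField K],
      gross_zagier N W K)
    (hKo : ∀ (N : ℕ) [NeZero N] (W : WeierstrassCurve ℚ) (K : Type) [Field K] [NumberField K],
      kolyvagin N W K)
    (hB : ∀ (N : ℕ) [NeZero N] (W : WeierstrassCurve ℚ) (K : Type) [Field K] [NumberField K],
      Kolyvagin1990_padicValNat_card_sha_le N W K)
    (hSk : Skinner2016.thmC_padicValRat_bsd_rank_zero) (hWu : sha_dvd_analyticSha)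
    (hGZK : rank_eq_analyticRank_of_analyticRank_le_one) (hmod : hasEntireLFunction_rat)
    (hnf : exists_isNewformOf) (hHL : HoffsteinLuo1997_exists_twist_L_one_ne_zero)
    (hMaz : mazur_not_dvd_maninConstant_of_odd)
    (hPT : ∀ (K : Type) [Field K] [NumberField K], poitouTate_sum_localTatePairing_eq_zero K)
    (hEP : ∀ (K : Type) [Field K] [NumberField K] (v : HeightOneSpectrum (𝓞 K)),
      localEulerPoincareCharacteristic (v.adicCompletion K))
    (hFH : friedbergHoffstein_exists_twist_ne_zero_inertAt)
    (hBR : localTamagawaNumber_quadraticTwist_two_mem_of_goodReduction)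
    (hSkA : thmA_charIdeal_multiplicative) (hJn : thm61_nonsplitMultiplicative)
    (hHn : exists_isMultCanonical) (hD : thm1_padicBSD_rankOne_multiplicative)
    (hpar : nonempty_modularParametrizationData)
    -- ROAD (a) NONSPLIT(3) ∧ (ram): a non-split REGMULT certificate for every such pair
    (hcert : ∀ (W : WeierstrassCurve ℚ) [W.IsElliptic] [W.IsGloballyMinimal],
      ClassX11b W 3 → Ram W 3 → ¬ W.HasSplitMultiplicativeReductionAtPrime 3 →
        ∃ (P : W.toAffine.Point) (m : ℕ), RegMult.CertNonsplit W 3 P m)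
    -- ROAD (b) SPLIT(3) ∧ (ram): THE open input, S0 currency, split cells only — no source at `3`
    (hL : ∀ (W : WeierstrassCurve ℚ) [W.IsElliptic] [W.IsGloballyMinimal],
      ClassX11b W 3 → Ram W 3 → W.HasSplitMultiplicativeReductionAtPrime 3 → StepLAt W)
    (hSh : ∀ (W : WeierstrassCurve ℚ) [W.IsElliptic] [W.IsGloballyMinimal],
      ClassX11b W 3 → Ram W 3 → W.HasSplitMultiplicativeReductionAtPrime 3 → ¬ ShapeAlpha W →
        ¬ ShapeGamma W → 3 ∣ W.tamagawaProduct → P2ShimuraDisplaysAt W 3)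
    (hUα : ∀ (W : WeierstrassCurve ℚ) [W.IsElliptic] [W.IsGloballyMinimal],
      ClassX11b W 3 → Ram W 3 → ShapeAlpha W → Typed.MissingUpperBoundAt W 3)
    (hUγ : ∀ (W : WeierstrassCurve ℚ) [W.IsElliptic] [W.IsGloballyMinimal],
      ClassX11b W 3 → Ram W 3 → W.HasSplitMultiplicativeReductionAtPrime 3 → ¬ ShapeAlpha W →
        ShapeGamma W → Typed.MissingUpperBoundAt W 3)
    -- ROAD (d) and the corner: unchanged
    (hL₀ : ∀ (W : WeierstrassCurve ℚ) [W.IsElliptic] [W.IsGloballyMinimal],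
      ClassX11b W 3 → ¬ Ram W 3 → Surj W 3 → StepLAt W)
    (hU₀ : ∀ (W : WeierstrassCurve ℚ) [W.IsElliptic] [W.IsGloballyMinimal],
      ClassX11b W 3 → Surj W 3 → ¬ Ram W 3 → Typed.MissingUpperBoundAt W 3)
    (hCs : ∀ (W : WeierstrassCurve ℚ) [W.IsElliptic] [W.IsGloballyMinimal],
      ClassX11b W 3 → ¬ Surj W 3 → 3 ∣ padicValInt 3 W.minimalDiscriminantInt → ¬ Ram W 3 →
        W.HasSplitMultiplicativeReductionAtPrime 3 → Typed.MissingPPartAt W 3)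
    (hCn : ∀ (W : WeierstrassCurve ℚ) [W.IsElliptic] [W.IsGloballyMinimal],
      ClassX11b W 3 → ¬ Surj W 3 → 3 ∣ padicValInt 3 W.minimalDiscriminantInt → ¬ Ram W 3 →
        ¬ W.HasSplitMultiplicativeReductionAtPrime 3 → Typed.MissingPPartAt W 3)
    (W : WeierstrassCurve ℚ) [W.IsElliptic] [W.IsGloballyMinimal] (hX : ClassX11b W 3) :
    BSDp W 3 :=
  forall_bsdp_of_classRecord hGZ hKo hB hSk hWu hGZK hmod hnf hHL hMaz hPT hEP hFH hBR hSkA hJn hHn hD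
    hpar (hReg_of_certNonsplit hGZK hcert) hL hSh hUα hUγ hL₀ hU₀ hCs hCn W hX

end Summit.BirchSwinnertonDyer.Rank1Residual.X11b.Three

end
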